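import Summits.KontsevichZagierPeriods.KontsevichZagierPeriods.Theses.IsogenyCertificates
import Literature.NumberTheory.Transcendental.KZCalculus
import Literature.NumberTheory.EllipticCurves.RealLatticePeriod
import Literature.ModelTheory.ExponentialFields.CylindricalDecompositionProofs
import Literature.NumberTheory.Transcendental.SemialgebraicMapsProofs

/-!
# Crux `RealPeriodSectorComplete` (stmt-KontsevichZagierPeriods-5381), line `period-ratio-branch-cov`,
stub `stub_continuousBranchSemialgebraic`: a continuous branch of a semialgebraic curve is semialgebraic

Pure real algebraic geometry (no elliptic curves). Let `Z ⊆ ℝ²` be `ℚ`-semialgebraic with finite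
vertical fibres over the half-line `(e, ∞)`, and let `Φ` be continuous on `(e, ∞)` with graph inside
`Z`. Then the graph `{(x, Φ x) | e < x}` is `ℚ`-semialgebraic, provided the half-line
`{p : ℝ¹ | e < p 0}` is (in the line `e` is real algebraic, not rational, so this is a hypothesis).

Proof. Take a cylindrical decomposition of the line adapted to `Z`
(`IsSemialgebraic.exists_cylindricalDecomposition.exists_fibre_eq`, Basu–Pollack–Roy 2006,
Cor. 5.7, proved in the tree): over each cell `S` of the line the vertical fibres of `Z` are the
values of finitely many continuous `ℚ`-semialgebraic sections `ξ_{S,0} < ⋯ < ξ_{S,ℓ-1}` (graphs)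
together with finitely many bands between consecutive sections. Over a point `x ∈ S` with `e < x`
the fibre is finite, so `Φ x`, which lies in it, is not in a band (a band fibre is a non-empty open
subset of `ℝ`, hence infinite): `Φ x = ξ_{S,j}(x)` for some `j`. The cell `S` is a point or an open
interval, so `S ∩ (e, ∞)` is preconnected; the branch index `j` is a continuous (the sections are
continuous and pairwise distinct) map to a discrete space, hence constant on `S ∩ (e, ∞)`
(`IsPreconnected.constant`). So the graph of `Φ` over `(e, ∞)` is the finite union over the cells
`S` and the indices `j` attained on `S ∩ (e, ∞)` of `graph(ξ_{S,j}) ∩ {e < p 0}`, each of which is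
`ℚ`-semialgebraic.

Sources: S. Basu, R. Pollack, M.-F. Roy, *Algorithms in Real Algebraic Geometry* (2006), Def. 5.1,
Cor. 5.7 (tree files `CylindricalDecomposition(.Proofs).lean`); the rest is folklore point-set
topology. No new definitions, no named facts.
-/

noncomputable section

open MeasureTheory Set Filter
open scoped PeriodPair Topology
open Literature.ModelTheory.ExponentialFields
open Literature.NumberTheory.Transcendental
open Literature.NumberTheory.Transcendental.KZ

namespace Summit.KontsevichZagierPeriods.IsogenyCertificates.RealPeriodSectorCompleteStubs.ContinuousBranchSemialgebraic

/-- **Uniqueness of the branch index along a preconnected set.** If finitely many real functions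
`ζ₀ < ζ₁ < ⋯ < ζ_{ℓ-1}` (pointwise strictly increasing in the index) and `ψ` are continuous on a
preconnected set `J`, and at every point of `J` the value of `ψ` is one of the `ζ_j`, then the index
`j` is the same at all points of `J`: the index is a continuous map from `J` to the discrete space
`Fin ℓ` (`IsPreconnected.constant`). [folklore] -/
theorem eq_section_of_eq_section {X : Type*} [TopologicalSpace X] {J : Set X}
    (hJ : IsPreconnected J) {l : ℕ} {ζ : Fin l → X → ℝ} {ψ : X → ℝ}
    (hζ : ∀ j, ContinuousOn (ζ j) J) (hψ : ContinuousOn ψ J)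
    (hmono : ∀ x ∈ J, StrictMono fun j => ζ j x) (hex : ∀ x ∈ J, ∃ j, ψ x = ζ j x)
    {x x' : X} (hx : x ∈ J) (hx' : x' ∈ J) {j : Fin l} (hj : ψ x = ζ j x) :
    ψ x' = ζ j x' := by
  classical
  -- the branch index (extended by `j` off `J`)
  set ι : X → Fin l := fun y => if h : y ∈ J then (hex y h).choose else j with hι
  have hιJ : ∀ y ∈ J, ψ y = ζ (ι y) y := fun y hy => by
    simp only [hι, dif_pos hy]
    exact (hex y hy).choose_spec
  -- it is continuous on `J` for the discrete topology on `Fin l`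
  have hcont : ContinuousOn ι J := by
    intro y hy
    rw [ContinuousWithinAt, nhds_discrete (Fin l), tendsto_pure]
    have h1 : ∀ i, i ≠ ι y → ∀ᶠ z in 𝓝[J] y, ψ z ≠ ζ i z := by
      intro i hi
      have hne : ψ y - ζ i y ≠ 0 := by
        rw [hιJ y hy, sub_ne_zero]
        exact fun h => hi ((hmono y hy).injective h).symm
      have ht : Tendsto (fun z => ψ z - ζ i z) (𝓝[J] y) (𝓝 (ψ y - ζ i y)) :=
        (hψ y hy).sub (hζ i y hy)
      exact (ht.eventually_ne hne).mono fun z hz h => hz (sub_eq_zero.2 h)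
    have h2 : ∀ᶠ z in 𝓝[J] y, ∀ i, i ≠ ι y → ψ z ≠ ζ i z :=
      eventually_all.2 fun i => eventually_imp_distrib_left.2 (h1 i)
    filter_upwards [h2, self_mem_nhdsWithin] with z hz hzJ
    by_contra hne
    exact hz (ι z) hne (hιJ z hzJ)
  have hconst : ι x = ι x' := hJ.constant hcont hx hx'
  have hjx : ι x = j := (hmono x hx).injective ((hιJ x hx).symm.trans hj)
  rw [hιJ x' hx', ← hconst, hjx]

/-- **Level-`1` cells are intervals.** A cell of a cylindrical decomposition of the line `ℝ¹` is a
point or an open interval (a graph or a band over the one-point space `ℝ⁰`,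
[BasuPollackRoy2006, Def. 5.1]); in particular its intersection with a half-line `{e < x 0}` is
preconnected. [cite: BasuPollackRoy2006, Def. 5.1] -/
theorem isPreconnected_cell_inter {𝒮 : Finset (Set (Fin 1 → ℝ))}
    (h𝒮 : IsCylindricalDecomposition ℚ 1 𝒮) {S : Set (Fin 1 → ℝ)} (hS : S ∈ 𝒮) (e : ℝ) :
    IsPreconnected (S ∩ {x | e < x 0}) := by
  obtain ⟨-, -, 𝒮₀, h𝒮₀, l₀, ξ₀, -, -, -, hmem⟩ :=
    (isCylindricalDecomposition_succ (k := ℚ) (n := 0)).1 h𝒮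
  rw [isCylindricalDecomposition_zero] at h𝒮₀
  subst h𝒮₀
  obtain ⟨S₀, hS₀, hT⟩ := (hmem S).1 hS
  rw [Finset.mem_singleton] at hS₀
  subst hS₀
  -- parametrise the line `ℝ¹` by `ℝ`
  set g : ℝ → (Fin 1 → ℝ) := fun t _ => t with hg
  have hgc : Continuous g := continuous_pi fun _ => continuous_id
  have hgx : ∀ x : Fin 1 → ℝ, g (x 0) = x := fun x => funext fun i => by
    rw [Fin.fin_one_eq_zero i]
  have hinit : ∀ t, Fin.init (g t) = Fin.init (g 0) := fun t => Subsingleton.elim _ _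
  have himage : S ∩ {x | e < x 0} = g '' {t | g t ∈ S ∧ e < t} := by
    ext x
    constructor
    · rintro ⟨hxS, hxe⟩
      exact ⟨x 0, ⟨by rw [hgx]; exact hxS, hxe⟩, hgx x⟩
    · rintro ⟨t, ⟨htS, hte⟩, rfl⟩
      exact ⟨htS, hte⟩
  rw [himage]
  refine IsPreconnected.image ?_ g hgc.continuousOn
  rcases hT with ⟨j, rfl⟩ | ⟨j, rfl⟩
  · -- a point
    refine Set.Subsingleton.isPreconnected ?_
    rintro t ⟨ht, -⟩ t' ⟨ht', -⟩
    rw [mem_graphOver_iff] at ht ht'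
    have h1 : t = ξ₀ univ j (Fin.init (g 0)) := by rw [← hinit t]; exact ht.2
    have h2 : t' = ξ₀ univ j (Fin.init (g 0)) := by rw [← hinit t']; exact ht'.2
    exact h1.trans h2.symm
  · -- an open interval
    refine Set.OrdConnected.isPreconnected ⟨?_⟩
    rintro t ⟨ht, hte⟩ t' ⟨ht', -⟩ u ⟨htu, hut'⟩
    refine ⟨?_, lt_of_lt_of_le hte htu⟩
    rw [mem_bandOver_iff] at ht ht' ⊢
    rw [hinit u]
    rw [hinit t] at ht
    rw [hinit t'] at ht'
    exact ⟨mem_univ _, lt_of_lt_of_le ht.2.1 (EReal.coe_le_coe_iff.2 htu),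
      lt_of_le_of_lt (EReal.coe_le_coe_iff.2 hut') ht'.2.2⟩

/-- **A continuous branch of a semialgebraic set with finite vertical fibres is semialgebraic**
(stub `stub_continuousBranchSemialgebraic` of the line `period-ratio-branch-cov`). If `Z ⊆ ℝ²` is
`ℚ`-semialgebraic with finite vertical fibres over `(e, ∞)`, the half-line `{e < p 0} ⊆ ℝ¹` is
`ℚ`-semialgebraic, and `Φ` is continuous on `(e, ∞)` with graph in `Z`, then the graph of `Φ` over
`(e, ∞)` is `ℚ`-semialgebraic. Proof by the cylindrical decomposition of the line adapted to `Z`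
[BasuPollackRoy2006, Cor. 5.7]: over each cell, `Φ` follows one continuous semialgebraic section
(finite fibres exclude the bands; connectedness of the cell fixes the section), so the graph is a
finite union of pieces of section graphs. [cite: BasuPollackRoy2006, Cor. 5.7] -/
theorem stub_continuousBranchSemialgebraic : ∀ (e : ℝ) (Φ : ℝ → ℝ) (Z : Set (Fin 2 → ℝ)), IsSemialgebraic ℚ {p : Fin 1 → ℝ | e < p 0} → IsSemialgebraic ℚ Z → (∀ x : ℝ, e < x → {y : ℝ | (![x, y] : Fin 2 → ℝ) ∈ Z}.Finite) → ContinuousOn Φ (Ioi e) → (∀ x : ℝ, e < x → (![x, Φ x] : Fin 2 → ℝ) ∈ Z) → IsSemialgebraic ℚ {p : Fin 2 → ℝ | e < p 0 ∧ p 1 = Φ (p 0)} := by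
  intro e Φ Z hE hZ hfin hcont hgraph
  classical
  -- coordinates: `Fin.snoc x t = (x 0, t)` in `![_, _]` notation
  have hsnoc : ∀ (x : Fin 1 → ℝ) (t : ℝ),
      (Fin.snoc x t : Fin 2 → ℝ) ∈ Z ↔ (![x 0, t] : Fin 2 → ℝ) ∈ Z := by
    intro x t
    have h : (Fin.snoc x t : Fin 2 → ℝ) = ![x 0, t] := by
      ext i
      fin_cases i
      · rfl
      · rfl
    rw [h]
  obtain ⟨𝒮, l, ξ, h𝒮, hξc, -, hmono, hcells, hfib⟩ :=
    IsSemialgebraic.exists_cylindricalDecomposition.exists_fibre_eq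
      (IsSemialgebraic.exists_cylindricalDecomposition_holds (k := ℚ)) hZ
  have hpart := h𝒮.isPartition
  -- (i) over a point `x` of a cell with `e < x 0`, `Φ (x 0)` is a section value
  have hex : ∀ S ∈ 𝒮, ∀ x ∈ S, e < x 0 → ∃ j : Fin (l S), Φ (x 0) = ξ S j x := by
    intro S hS x hxS hxe
    obtain ⟨G, B, -, -, hfibx⟩ := hfib S hS
    have hF := Set.ext_iff.1 (hfibx x hxS)
    have h1 : (Fin.snoc x (Φ (x 0)) : Fin 2 → ℝ) ∈ Z :=
      (hsnoc x (Φ (x 0))).2 (hgraph (x 0) hxe)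
    have hmem := (hF (Φ (x 0))).1 h1
    rcases hmem with hmem | hmem
    · simp only [mem_iUnion, mem_singleton_iff, exists_prop] at hmem
      obtain ⟨j, -, hj⟩ := hmem
      exact ⟨j, hj⟩
    · simp only [mem_iUnion, mem_setOf_eq, exists_prop] at hmem
      obtain ⟨j, hjB, hjt⟩ := hmem
      -- the band through `Φ (x 0)` is an infinite subset of the finite fibre
      exfalso
      have hopen : IsOpen (((↑) : ℝ → EReal) ⁻¹'
          Ioo (bandLower (ξ S) j x) (bandUpper (ξ S) j x)) :=
        isOpen_Ioo.preimage continuous_coe_real_ereal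
      have hjt' : Φ (x 0) ∈ ((↑) : ℝ → EReal) ⁻¹'
          Ioo (bandLower (ξ S) j x) (bandUpper (ξ S) j x) := hjt
      have hinf := infinite_of_mem_nhds (Φ (x 0)) (hopen.mem_nhds hjt')
      refine hinf ((hfin (x 0) hxe).subset fun t ht => ?_)
      have ht' := (hF t).2 (Or.inr (mem_iUnion₂.2 ⟨j, hjB, ht⟩))
      exact (hsnoc x t).1 ht'
  -- (ii) the branch index is constant along each cell
  have hconst : ∀ S ∈ 𝒮, ∀ x ∈ S, ∀ x' ∈ S, e < x 0 → e < x' 0 → ∀ j : Fin (l S),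
      Φ (x 0) = ξ S j x → Φ (x' 0) = ξ S j x' := by
    intro S hS x hxS x' hx'S hxe hx'e j hj
    exact eq_section_of_eq_section (isPreconnected_cell_inter h𝒮 hS e) (ψ := fun x => Φ (x 0))
      (fun j => (hξc S hS j).mono inter_subset_left)
      (hcont.comp (continuous_apply 0).continuousOn fun x hx => hx.2)
      (fun x hx => hmono S hS x hx.1) (fun x hx => hex S hS x hx.1 hx.2) ⟨hxS, hxe⟩ ⟨hx'S, hx'e⟩ hj
  -- (iii) the graph is a finite union of pieces of section graphs
  have hE2 : IsSemialgebraic ℚ {p : Fin 2 → ℝ | e < p 0} := hE.setOf_init_mem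
  have key : {p : Fin 2 → ℝ | e < p 0 ∧ p 1 = Φ (p 0)} =
      ⋃ S ∈ 𝒮, ⋃ j ∈ (Finset.univ.filter fun j : Fin (l S) =>
        ∃ x ∈ S, e < x 0 ∧ Φ (x 0) = ξ S j x),
          (graphOver S (ξ S j) ∩ {p : Fin 2 → ℝ | e < p 0}) := by
    ext p
    simp only [mem_iUnion, mem_inter_iff, mem_setOf_eq, Finset.mem_filter, Finset.mem_univ,
      true_and, exists_prop, mem_graphOver_iff]
    constructor
    · rintro ⟨hpe, hp1⟩
      obtain ⟨S, ⟨hS, hxS⟩, -⟩ := hpart.2 (Fin.init p)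
      have hS' : S ∈ 𝒮 := Finset.mem_coe.1 hS
      obtain ⟨j, hj⟩ := hex S hS' (Fin.init p) hxS hpe
      exact ⟨S, hS', j, ⟨Fin.init p, hxS, hpe, hj⟩, ⟨hxS, hp1.trans hj⟩, hpe⟩
    · rintro ⟨S, hS, j, ⟨x₁, hx₁S, hx₁e, hx₁j⟩, ⟨hxS, hpj⟩, hpe⟩
      exact ⟨hpe, hpj.trans (hconst S hS x₁ hx₁S (Fin.init p) hxS hx₁e hpe j hx₁j).symm⟩
  rw [key]
  refine IsSemialgebraic.biUnion 𝒮 _ fun S hS => IsSemialgebraic.biUnion _ _ fun j _ => ?_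
  exact ((hcells S hS).1 j).inter hE2

end Summit.KontsevichZagierPeriods.IsogenyCertificates.RealPeriodSectorCompleteStubs.ContinuousBranchSemialgebraic

end
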